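import Summits.CriticalPhenomena.Ising3DConformalLimit.Theses.GaussianScaleMixture
import Summits.CriticalPhenomena.Ising3DConformalLimit.Theorems.GaussianScaleMixtureLimitKernelGSMLaplace
import Literature.Probability.LatticeModels.HighDimPointwiseTriviality
import HarnessLib

/-!
# `LimitKernelGSM` (item stmt-CriticalPhenomena-8368, route GaussianScaleMixture)

`CriticalTwoPointGSM → ∀ ρ Δ S, …, ∃ ν, ν {∃ i, sᵢ < 0} = 0 ∧ ∀ x ≠ 0, Integrable … ∧
S 2 ![0, x] = ∫ exp(-∑ sᵢ xᵢ²) dν`: if the critical two-point function `⟨σ₀σ_x⟩_{β_c}` of the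
n.n. Ising model on `ℤ³` is a Gaussian scale mixture with mixing measure `ν`, then the two-point
kernel of EVERY scale-covariant pointwise scaling limit of `criticalCorr 3` is a Gaussian scale
mixture off the origin (closed as `limitKernelGSM_proof`).

Proof. (1) `tendsto_rescaled_laplace`: `ρ(δ)² ∫ exp(-∑ sᵢ(xᵢ/δ)²) dν → S₂(0,x)` for `x ≠ 0` — the
rescaled correlator `ρ(δ)²⟨σ₀σ_{[x/δ]}⟩` is this Laplace integral at the rounded point, the
rounding is absorbed by dilating `x ↦ c x` (`c → 1`) thanks to the antitonicity of the Laplace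
integral in the squared coordinates (`integral_exp_anti`, floor lemmas) and the continuity of
`c ↦ S₂(0, c x) = c^{-2Δ} S₂(0,x)`. Consequences: evenness and antitonicity of the limit kernel in
`x²` (`two_le_two_of_sq_le`, `two_eq_two_of_sq_eq`). (2) `eventually_lt_two`: the limit kernel is
lower semicontinuous from the upper orthant (mesh cubes are half-open upwards + local uniformity of
the convergence), hence `Φ(v) := S₂(0, √v)` is inner-continuous at the faces of the octant.
(3) `exists_measure_laplace_eq_of_tendsto` (helper file) applied to the rescaled mixing measures
`ρ(δ)² · (s ↦ s/δ²)_* ν`. Only the `n = 2` clause of the scaling limit and scale covariance are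
used (translation invariance, non-degeneracy, `ρ > 0`, exchangeability of `ν` are not needed).

References: Messager–Miracle-Solé (1977) for the monotonicity heuristics; Berg–Christensen–Ressel
(1984) §4.6 for the Bernstein–Widder statement this file avoids.
-/

noncomputable section

namespace Summit.CriticalPhenomena.Ising3DConformalLimit.Theorems.LimitKernelGSM

open MeasureTheory Filter Topology Set Literature.Probability.LatticeModels
open scoped ENNReal NNReal

/-! ## The rescaled Laplace transform converges to the limit kernel -/

/-- **Lattice-to-Laplace limit.** If the critical two-point function is the Gaussian scale mixture
of `ν`, then for every pointwise scaling limit `S` (scale covariant) and `x ≠ 0`,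
`ρ(δ)² ∫ exp(-∑ sᵢ (xᵢ/δ)²) dν → S₂(0, x)` as `δ → 0⁺`: the lattice rounding in
`ρ(δ)²⟨σ₀σ_{[x/δ]}⟩` is absorbed by the monotonicity of the Laplace integral in the squared
coordinates and the continuity of `c ↦ S₂(0, c x)` (scale covariance). [folklore] -/
theorem tendsto_rescaled_laplace {ν : Measure (Fin 3 → ℝ)} [IsFiniteMeasure ν]
    (hν0 : ν {s | ∃ i, s i < 0} = 0)
    (hG : ∀ y : Site 3, criticalTwoPoint 3 y = ∫ s, Real.exp (-∑ i, s i * ((y i : ℝ)) ^ 2) ∂ν)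
    {ρ : ℝ → ℝ} {Δ : ℝ} {S : CorrFamily 3}
    (hlim : HasPointwiseScalingLimit (criticalCorr 3) ρ S) (hsc : IsScaleCovariant Δ S)
    {x : EuclideanSpace ℝ (Fin 3)} (hx : x ≠ 0) :
    Tendsto (fun δ => ρ δ ^ 2 * ∫ s, Real.exp (-∑ i, s i * (x i / δ) ^ 2) ∂ν) (𝓝[>] 0)
      (𝓝 (S 2 ![0, x])) := by
  -- (a) rescaled pair correlators in Laplace form
  have hA : ∀ y : EuclideanSpace ℝ (Fin 3), y ≠ 0 → Tendsto (fun δ => ρ δ ^ 2 *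
      ∫ s, Real.exp (-∑ i, s i * ((⌊y i / δ⌋ : ℤ) : ℝ) ^ 2) ∂ν) (𝓝[>] 0) (𝓝 (S 2 ![0, y])) := by
    intro y hy
    refine ((hlim 2).tendsto_at (pair_mem_nonCoincident hy.symm)).congr fun δ => ?_
    rw [rescaledCorrelator_apply, latticeApprox_comp_two]
    have h0 : latticeApprox δ ((![0, y] : Fin 2 → EuclideanSpace ℝ (Fin 3)) 0) = 0 := by
      funext i; simp [latticeApprox]
    have h1 : (![0, y] : Fin 2 → EuclideanSpace ℝ (Fin 3)) 1 = y := rfl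
    rw [h0, h1, criticalCorr_two_pair, sub_zero, hG]
    rfl
  -- (b) a positive lower bound for the nonzero `|x i|`
  obtain ⟨m, hm, hmx⟩ := exists_pos_le_abs_of_ne_zero (WithLp.ofLp x)
  -- (c) continuity of the limit kernel along the ray through `x` (scale covariance)
  have hray : Tendsto (fun c : ℝ => S 2 ![0, c • x]) (𝓝 1) (𝓝 (S 2 ![0, x])) := by
    have hcov : ∀ c : ℝ, 0 < c → S 2 ![0, c • x] = c ^ (-(2:ℝ) * Δ) * S 2 ![0, x] := by
      intro c hc
      have h := hsc 2 c hc ![0, x]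
      have e : (fun i => c • (![0, x] : Fin 2 → EuclideanSpace ℝ (Fin 3)) i) = ![0, c • x] := by
        funext i; fin_cases i <;> simp
      rw [e] at h
      simpa using h
    have h1 : Tendsto (fun c : ℝ => c ^ (-(2:ℝ) * Δ) * S 2 ![0, x]) (𝓝 1)
        (𝓝 ((1:ℝ) ^ (-(2:ℝ) * Δ) * S 2 ![0, x])) :=
      ((Real.continuousAt_rpow_const 1 _ (Or.inl one_ne_zero)).tendsto).mul tendsto_const_nhds
    rw [Real.one_rpow, one_mul] at h1
    refine h1.congr' ?_
    filter_upwards [Ioi_mem_nhds one_pos] with c hc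
    exact (hcov c hc).symm
  rw [tendsto_order]
  constructor
  · intro a ha
    obtain ⟨c, hc1, hca⟩ : ∃ c : ℝ, 1 < c ∧ a < S 2 ![0, c • x] := by
      have h1 : ∀ᶠ c in 𝓝[>] (1:ℝ), a < S 2 ![0, c • x] :=
        (hray.eventually (lt_mem_nhds ha)).filter_mono nhdsWithin_le_nhds
      obtain ⟨c, hc, hc'⟩ := (h1.and self_mem_nhdsWithin).exists
      exact ⟨c, hc', hc⟩
    have hcx : c • x ≠ 0 := smul_ne_zero (by positivity) hx
    have hθ : 0 < (c - 1) * m := mul_pos (by linarith) hm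
    filter_upwards [(tendsto_order.1 (hA (c • x) hcx)).1 a hca, Ioo_mem_nhdsGT hθ] with δ hδa hδ
    refine hδa.trans_le (mul_le_mul_of_nonneg_left ?_ (sq_nonneg _))
    refine integral_exp_anti hν0 (fun i => sq_nonneg _) fun i => ?_
    rw [PiLp.smul_apply, smul_eq_mul]
    refine sq_le_sq.2 (abs_div_le_abs_floor hδ.1 hc1.le fun hxi => hδ.2.le.trans ?_)
    exact mul_le_mul_of_nonneg_left (hmx i hxi) (by linarith)
  · intro b hb
    obtain ⟨c, hc0, hc1, hcb⟩ : ∃ c : ℝ, 0 < c ∧ c < 1 ∧ S 2 ![0, c • x] < b := by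
      have h1 : ∀ᶠ c in 𝓝[<] (1:ℝ), S 2 ![0, c • x] < b :=
        (hray.eventually (gt_mem_nhds hb)).filter_mono nhdsWithin_le_nhds
      obtain ⟨c, hc, hc'⟩ := (h1.and (Ioo_mem_nhdsLT one_half_lt_one)).exists
      exact ⟨c, by linarith [hc'.1], hc'.2, hc⟩
    have hcx : c • x ≠ 0 := smul_ne_zero hc0.ne' hx
    have hθ : 0 < (1 - c) * m := mul_pos (by linarith) hm
    filter_upwards [(tendsto_order.1 (hA (c • x) hcx)).2 b hcb, Ioo_mem_nhdsGT hθ] with δ hδb hδ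
    refine lt_of_le_of_lt (mul_le_mul_of_nonneg_left ?_ (sq_nonneg _)) hδb
    refine integral_exp_anti hν0 (fun i => sq_nonneg _) fun i => ?_
    rw [PiLp.smul_apply, smul_eq_mul]
    refine sq_le_sq.2 (abs_floor_le_abs_div hδ.1 hc0 hc1.le fun hxi => hδ.2.le.trans ?_)
    exact mul_le_mul_of_nonneg_left (hmx i hxi) (by linarith)

/-- The limit kernel depends only on the squared coordinates (evenness), and is antitone in them:
`xᵢ² ≤ yᵢ²` for all `i` and `x ≠ 0` give `S₂(0,y) ≤ S₂(0,x)`. [folklore] -/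
theorem two_le_two_of_sq_le {ν : Measure (Fin 3 → ℝ)} [IsFiniteMeasure ν]
    (hν0 : ν {s | ∃ i, s i < 0} = 0)
    (hG : ∀ y : Site 3, criticalTwoPoint 3 y = ∫ s, Real.exp (-∑ i, s i * ((y i : ℝ)) ^ 2) ∂ν)
    {ρ : ℝ → ℝ} {Δ : ℝ} {S : CorrFamily 3}
    (hlim : HasPointwiseScalingLimit (criticalCorr 3) ρ S) (hsc : IsScaleCovariant Δ S)
    {x y : EuclideanSpace ℝ (Fin 3)} (hx : x ≠ 0) (hxy : ∀ i, (x i) ^ 2 ≤ (y i) ^ 2) :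
    S 2 ![0, y] ≤ S 2 ![0, x] := by
  have hy : y ≠ 0 := by
    intro hy0
    apply hx
    ext i
    have := hxy i
    rw [hy0, PiLp.zero_apply] at this
    simpa using le_antisymm (by simpa using this) (sq_nonneg (x i))
  refine le_of_tendsto_of_tendsto' (tendsto_rescaled_laplace hν0 hG hlim hsc hy)
    (tendsto_rescaled_laplace hν0 hG hlim hsc hx) fun δ => ?_
  refine mul_le_mul_of_nonneg_left (integral_exp_anti hν0 (fun i => sq_nonneg _) fun i => ?_)
    (sq_nonneg _)
  rw [div_pow, div_pow]
  exact div_le_div_of_nonneg_right (hxy i) (sq_nonneg _)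

/-- Evenness of the limit kernel: it depends on `x` only through the squared coordinates.
[folklore] -/
theorem two_eq_two_of_sq_eq {ν : Measure (Fin 3 → ℝ)} [IsFiniteMeasure ν]
    (hν0 : ν {s | ∃ i, s i < 0} = 0)
    (hG : ∀ y : Site 3, criticalTwoPoint 3 y = ∫ s, Real.exp (-∑ i, s i * ((y i : ℝ)) ^ 2) ∂ν)
    {ρ : ℝ → ℝ} {Δ : ℝ} {S : CorrFamily 3}
    (hlim : HasPointwiseScalingLimit (criticalCorr 3) ρ S) (hsc : IsScaleCovariant Δ S)
    {x y : EuclideanSpace ℝ (Fin 3)} (hx : x ≠ 0) (hxy : ∀ i, (x i) ^ 2 = (y i) ^ 2) :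
    S 2 ![0, y] = S 2 ![0, x] :=
  le_antisymm (two_le_two_of_sq_le hν0 hG hlim hsc hx fun i => (hxy i).le)
    (two_le_two_of_sq_le hν0 hG hlim hsc
      (fun hy0 => hx (PiLp.ext fun i => by
        have := hxy i; rw [hy0, PiLp.zero_apply] at this; simpa using this))
      fun i => (hxy i).ge)

/-! ## Inner continuity of the limit kernel at the coordinate planes -/

/-- **Continuity from the upper orthant.** At `x ≥ 0`, `x ≠ 0`, the limit kernel is lower
semicontinuous along `y → x` with `y ≥ x` coordinatewise: the rescaled correlators are constant on
the half-open mesh cubes, which contain such `y` for `y` close to `x`, and the convergence is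
locally uniform. [folklore] -/
theorem eventually_lt_two {ρ : ℝ → ℝ} {S : CorrFamily 3}
    (hlim : HasPointwiseScalingLimit (criticalCorr 3) ρ S)
    {x : EuclideanSpace ℝ (Fin 3)} (hx : x ≠ 0) (hx0 : ∀ i, 0 ≤ x i) {a : ℝ} (ha : a < S 2 ![0, x]) :
    ∀ᶠ y in 𝓝 x, (∀ i, x i ≤ y i) → a < S 2 ![0, y] := by
  have hz : (![0, x] : Fin 2 → EuclideanSpace ℝ (Fin 3)) ∈ NonCoincident 3 2 :=
    pair_mem_nonCoincident hx.symm
  have hε : 0 < (S 2 ![0, x] - a) / 2 := by linarith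
  obtain ⟨t, ht, hev⟩ := Metric.tendstoLocallyUniformlyOn_iff.1 (hlim 2) _ hε _ hz
  obtain ⟨δ, hδt, hδ⟩ := (hev.and self_mem_nhdsWithin).exists
  obtain ⟨t', ht', htt⟩ := mem_nhdsWithin_iff_exists_mem_nhds_inter.1 ht
  have hcont : Continuous fun y : EuclideanSpace ℝ (Fin 3) =>
      (![0, y] : Fin 2 → EuclideanSpace ℝ (Fin 3)) := by fun_prop
  have h1 : {y : EuclideanSpace ℝ (Fin 3) | (![0, y] : Fin 2 → _) ∈ t'} ∈ 𝓝 x :=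
    hcont.continuousAt.preimage_mem_nhds ht'
  have h2 : {y : EuclideanSpace ℝ (Fin 3) | ∀ i, y i < δ * (((⌊x i / δ⌋ : ℤ) : ℝ) + 1)} ∈ 𝓝 x := by
    refine IsOpen.mem_nhds ?_ fun i => ?_
    · rw [Set.setOf_forall]
      exact isOpen_iInter_of_finite fun i => isOpen_lt (by fun_prop) continuous_const
    · have := Int.lt_floor_add_one (x i / δ)
      rwa [div_lt_iff₀ (mem_Ioi.1 hδ), mul_comm] at this
  filter_upwards [h1, h2] with y hy1 hy2 hxy
  have hδ0 : 0 < δ := mem_Ioi.1 hδ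
  -- the mesh cubes of `x` and `y` coincide
  have hfl : ∀ i, ⌊y i / δ⌋ = ⌊x i / δ⌋ := fun i => by
    rw [Int.floor_eq_iff]
    constructor
    · exact (Int.floor_le _).trans (div_le_div_of_nonneg_right (hxy i) hδ0.le)
    · rw [div_lt_iff₀ hδ0, mul_comm]
      exact hy2 i
  have hla : latticeApprox δ y = latticeApprox δ x := funext fun i => hfl i
  have hresc : rescaledCorrelator (criticalCorr 3) ρ 2 δ ![0, y] =
      rescaledCorrelator (criticalCorr 3) ρ 2 δ ![0, x] := by
    rw [rescaledCorrelator_apply, rescaledCorrelator_apply, latticeApprox_comp_two,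
      latticeApprox_comp_two]
    simp [hla]
  -- `y ≠ 0`, so both pairs are non-coincident and in `t`
  have hy : y ≠ 0 := by
    intro hy0
    apply hx
    ext i
    have h := hxy i
    rw [hy0, PiLp.zero_apply] at h
    simpa using le_antisymm h (hx0 i)
  have hyt : (![0, y] : Fin 2 → EuclideanSpace ℝ (Fin 3)) ∈ t :=
    htt ⟨hy1, pair_mem_nonCoincident hy.symm⟩
  have hxt : (![0, x] : Fin 2 → EuclideanSpace ℝ (Fin 3)) ∈ t := mem_of_mem_nhdsWithin hz ht
  have d1 := hδt _ hyt
  have d2 := hδt _ hxt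
  rw [hresc, Real.dist_eq] at d1
  rw [Real.dist_eq] at d2
  have := abs_lt.1 d1
  have := abs_lt.1 d2
  linarith


end Summit.CriticalPhenomena.Ising3DConformalLimit.Theorems.LimitKernelGSM

namespace Summit.CriticalPhenomena.Ising3DConformalLimit.Theorems

open MeasureTheory Filter Topology Set Literature.Probability.LatticeModels
open scoped ENNReal NNReal
open Summit.CriticalPhenomena.Ising3DConformalLimit.Theorems.LimitKernelGSM

/-! ## Assembly -/

/-- **LimitKernelGSM** (item stmt-CriticalPhenomena-8368, route GaussianScaleMixture): if the critical
two-point function of the n.n. Ising model on `ℤ³` is a Gaussian scale mixture (`CriticalTwoPointGSM`),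
then the two-point kernel `x ↦ S₂(0,x)` of every non-degenerate, translation-invariant,
scale-covariant pointwise scaling limit `S` of `criticalCorr 3` is a Gaussian scale mixture off the
origin: `S₂(0,x) = ∫ exp(-∑ sᵢxᵢ²) dν` for a measure `ν` on the closed octant, the integrand being
integrable at every `x ≠ 0`. Proof: `ρ(δ)²⟨σ₀σ_{[x/δ]}⟩` is, up to lattice rounding, the Laplace
transform of the rescaled mixing measure `ρ(δ)²·(s ↦ s/δ²)_*ν` at `x²`; these transforms converge
on the octant minus the origin (`tendsto_rescaled_laplace`), the limit is inner-continuous at the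
coordinate planes (`eventually_lt_two`), and pointwise limits of Laplace transforms of finite
orthant measures are Laplace transforms (`exists_measure_laplace_eq_of_tendsto`). [folklore] -/
theorem limitKernelGSM_proof :
    Summit.CriticalPhenomena.Ising3DConformalLimit.Theses.GaussianScaleMixture.LimitKernelGSM := by
  intro hGSM ρ Δ S _hρ hlim _hnd _htr hsc
  obtain ⟨ν, hP, hν0, -, hG⟩ := hGSM
  -- the candidate Laplace transform of the tangent measure
  let Φ : (Fin 3 → ℝ) → ℝ := fun v => S 2 ![0, WithLp.toLp 2 fun i => Real.sqrt (v i)]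
  -- the rescaled mixing measures `ρ(δ)² · (s ↦ s/δ²)_* ν`
  let μ : ℝ → Measure (Fin 3 → ℝ) := fun δ =>
    (ρ δ ^ 2).toNNReal • ν.map (fun s => (1 / δ ^ 2) • s)
  haveI hfin : ∀ δ, IsFiniteMeasure (μ δ) := fun δ => by
    dsimp only [μ]; infer_instance
  have hmeasO : MeasurableSet {s : Fin 3 → ℝ | ∃ i, s i < 0} := by
    rw [Set.setOf_exists]
    exact MeasurableSet.iUnion fun i => measurableSet_lt (measurable_pi_apply i) measurable_const
  have hsupp : ∀ δ, μ δ {s | ∃ i, s i < 0} = 0 := by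
    intro δ
    dsimp only [μ]
    rw [Measure.smul_apply, Measure.map_apply (measurable_const_smul _) hmeasO]
    refine smul_eq_zero_of_right _ (measure_mono_null (fun s hs => ?_) hν0)
    obtain ⟨i, hi⟩ := hs
    refine ⟨i, ?_⟩
    simp only [Pi.smul_apply, smul_eq_mul] at hi
    by_contra hsi
    exact absurd hi (not_lt.2 (mul_nonneg (by positivity) (not_lt.1 hsi)))
  -- nonzero points of the octant give nonzero square roots
  have hsqrt_ne : ∀ v : Fin 3 → ℝ, (∀ i, 0 ≤ v i) → v ≠ 0 →
      (WithLp.toLp 2 fun i => Real.sqrt (v i) : EuclideanSpace ℝ (Fin 3)) ≠ 0 := by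
    intro v hv hv0 h
    apply hv0
    funext i
    have : Real.sqrt (v i) = 0 := by
      have := congrArg (fun z : EuclideanSpace ℝ (Fin 3) => z i) h
      simpa using this
    exact (Real.sqrt_eq_zero (hv i)).1 this
  -- (1) convergence of the Laplace transforms of `μ δ`
  have hlimμ : ∀ v : Fin 3 → ℝ, (∀ i, 0 ≤ v i) → v ≠ 0 →
      Tendsto (fun δ => ∫ s, Real.exp (-∑ i, s i * v i) ∂(μ δ)) (𝓝[>] 0) (𝓝 (Φ v)) := by
    intro v hv hv0
    have hT := tendsto_rescaled_laplace hν0 hG hlim hsc (hsqrt_ne v hv hv0)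
    refine hT.congr' ?_
    filter_upwards [self_mem_nhdsWithin] with δ hδ
    dsimp only [μ]
    rw [integral_smul_nnreal_measure, integral_map (measurable_const_smul _).aemeasurable
      (Continuous.aestronglyMeasurable (by fun_prop)), NNReal.smul_def, smul_eq_mul,
      Real.coe_toNNReal _ (sq_nonneg _)]
    congr 1
    refine integral_congr_ae (Eventually.of_forall fun s => ?_)
    simp only [Pi.smul_apply, smul_eq_mul]
    congr 1
    congr 1
    refine Finset.sum_congr rfl fun i _ => ?_
    have hδ0 : (δ : ℝ) ≠ 0 := (mem_Ioi.1 hδ).ne'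
    rw [div_pow, Real.sq_sqrt (hv i)]
    field_simp
  -- (2) inner continuity of `Φ` at the boundary of the octant
  have hcontΦ : ∀ v : Fin 3 → ℝ, (∀ i, 0 ≤ v i) → v ≠ 0 →
      Tendsto (fun η : ℝ => Φ (fun i => v i + η)) (𝓝[>] 0) (𝓝 (Φ v)) := by
    intro v hv hv0
    set x : EuclideanSpace ℝ (Fin 3) := WithLp.toLp 2 fun i => Real.sqrt (v i) with hx_def
    have hx : x ≠ 0 := hsqrt_ne v hv hv0
    have hx0 : ∀ i, 0 ≤ x i := fun i => Real.sqrt_nonneg _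
    -- the path `η ↦ √(v + η)` tends to `x` from the upper orthant
    have hpath : Tendsto (fun η : ℝ =>
        (WithLp.toLp 2 fun i => Real.sqrt (v i + η) : EuclideanSpace ℝ (Fin 3))) (𝓝[>] 0) (𝓝 x) := by
      have hc : Continuous fun η : ℝ =>
          (WithLp.toLp 2 fun i => Real.sqrt (v i + η) : EuclideanSpace ℝ (Fin 3)) := by
        refine (PiLp.continuous_toLp 2 _).comp (continuous_pi fun i => ?_)
        fun_prop
      have := hc.tendsto 0
      simp only [add_zero] at this
      exact this.mono_left nhdsWithin_le_nhds
    rw [tendsto_order]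
    constructor
    · intro a ha
      have hev := eventually_lt_two hlim hx hx0 ha
      filter_upwards [hpath.eventually hev, self_mem_nhdsWithin] with η hη hη0
      refine hη fun i => ?_
      change Real.sqrt (v i) ≤ Real.sqrt (v i + η)
      exact Real.sqrt_le_sqrt (by linarith [mem_Ioi.1 hη0])
    · intro b hb
      filter_upwards [self_mem_nhdsWithin] with η hη0
      refine lt_of_le_of_lt (two_le_two_of_sq_le hν0 hG hlim hsc hx fun i => ?_) hb
      change (Real.sqrt (v i)) ^ 2 ≤ (Real.sqrt (v i + η)) ^ 2
      rw [Real.sq_sqrt (hv i), Real.sq_sqrt (by linarith [hv i, mem_Ioi.1 hη0])]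
      linarith [mem_Ioi.1 hη0]
  -- (3) the tangent measure
  obtain ⟨ν', hν'0, hrep⟩ := exists_measure_laplace_eq_of_tendsto μ hsupp Φ hlimμ hcontΦ
  refine ⟨ν', hν'0, fun x hx => ?_⟩
  have hxne : (fun i => (x i) ^ 2) ≠ 0 := by
    intro h
    apply hx
    ext i
    have := congr_fun h i
    simpa using this
  obtain ⟨hint, hval⟩ := hrep (fun i => (x i) ^ 2) (fun i => sq_nonneg _) hxne
  refine ⟨hint, ?_⟩
  rw [← hval]
  -- `Φ (x²) = S₂(0, |x|) = S₂(0, x)` by evenness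
  refine (two_eq_two_of_sq_eq hν0 hG hlim hsc hx fun i => ?_)|>.symm
  change (x i) ^ 2 = (Real.sqrt ((x i) ^ 2)) ^ 2
  rw [Real.sq_sqrt (sq_nonneg _)]


end Summit.CriticalPhenomena.Ising3DConformalLimit.Theorems

end
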